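import Literature.NumberTheory.Transcendental.PhilipponCriterionLevel
import Literature.NumberTheory.Transcendental.PhilipponCriterionStepBounds
import HarnessLib

/-!
# Philippon's criterion over Nesterenko's toolkit, XIII: the cut of the induction step — proofs only

`Literature/NumberTheory/Transcendental/PhilipponCriterionStepCut.lean` — proofs only (no new
definitions, nothing asserted). The central construction of Philippon's Lemme 2.14 (Publ. Math.
IHÉS 64 (1986), §3, pp. 43–45): from a prime `𝔓 = 𝔓_{N,r}` satisfying `(A_r)` at level `N` with rank
exactly `r ≥ 2`, the level `M`, a generator `Q = E M i` of `I_M` with `ʰQ ∉ 𝔓`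
(`PhilipponCriterionLevel.lean`), and the ideal `ρ(f)` of the intersection with its smallness —
"Premier cas : si `M = N`" (Cor. 2.3; here Prop. 4.11 with `δ ≤ max(‖Q‖_ω̄, |𝔓(ω̄)|)`), "Deuxième cas :
si `M < N`" (Prop. 2.5 with `η = S(M)/2R(M+1)`; here Prop. 4.11 when `‖Q‖_ω̄ ≤ ρ`, and otherwise
Cor. 4.12 with the integer `η = ⌈4ξ(M)⌉`, whose hypothesis `‖Q‖^η ≤ ρ²` is
`normAt_pow_eta_le_sq`). "Dans les deux cas on démontre donc la même majoration":

* `Setup.exists_cut` — a homogeneous unmixed `J` of rank `r − 1` with `V(J) = V((𝔓, E M i))`,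
  `|J(ω̄)| ≤ exp(−min(Λ_r(N) size_N(𝔓), S(N))/2)`, `size_N(J) ≤ 5 ξ(N) δ(N) (2 + m(k+3)) size_N(𝔓)` and
  `m³ deg J ≤ min(…)/4`, under explicit largeness hypotheses on `Λ_r(N)`, `C` and `N`.

## References

* [Philippon1986Criteres] P. Philippon, Publ. Math. IHÉS 64 (1986), §3, pp. 43–45.
* [NesterenkoPhilippon2001] LNM 1752 (2001), Ch. 3 Prop. 4.11, Cor. 4.12, Prop. 4.13 (pp. 40–41).
-/

noncomputable section

open MvPolynomial Real
open Literature.NumberTheory.Transcendental.Nesterenko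

attribute [local instance] MvPolynomial.gradedAlgebra

namespace Literature.NumberTheory.Transcendental

namespace PhilipponMain

namespace Setup

variable (𝒮 : Setup)

/-! ### Two more elementary bounds -/

/-- `ξ ≤ g/C` (as `g/C ≥ 1` and `1/(k+1) ≤ 1`). [folklore] -/
theorem ξ_le_g_div_C (N : ℕ) : 𝒮.ξ N ≤ 𝒮.g N / 𝒮.C := by
  unfold ξ
  have h1 : 1 ≤ 𝒮.g N / 𝒮.C := by rw [le_div_iff₀ 𝒮.C_pos, one_mul]; exact 𝒮.C_le_g N
  conv_rhs => rw [← rpow_one (𝒮.g N / 𝒮.C)]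
  apply rpow_le_rpow_of_exponent_le h1
  rw [div_le_one (by positivity)]
  linarith

/-- `δ(N) · δ(N)^{r₀−r} ≤ δ(N)^k` for `2 ≤ r` (as `r₀ ≤ k + 1`). [folklore] -/
theorem δ_mul_pow_le_pow_k {r : ℕ} (hr2 : 2 ≤ r) (hrr : r ≤ 𝒮.r₀) (N : ℕ) :
    𝒮.δ N * 𝒮.δ N ^ (𝒮.r₀ - r) ≤ 𝒮.δ N ^ 𝒮.k := by
  rw [← pow_succ']
  exact pow_le_pow_right₀ (𝒮.one_le_δ N) (by have := 𝒮.r₀_le; omega)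

/-- `5 m³ ξ(N) δ(N) deg 𝔓 ≤ S(N)/4` under `(i)_N` and `C ≥ 20 m³ D₀`. [folklore] -/
theorem deg_term_le_quarter_S {r : ℕ} (hr2 : 2 ≤ r) (hrr : r ≤ 𝒮.r₀) (N : ℕ) {𝔓 : Ideal (Rx 𝒮.m)}
    (hdeg : (ideg 𝔓 r : ℝ) ≤ 𝒮.D₀ * 𝒮.δ N ^ (𝒮.r₀ - r)) (hC : 20 * (𝒮.m : ℝ) ^ 3 * 𝒮.D₀ ≤ 𝒮.C) :
    5 * (𝒮.m : ℝ) ^ 3 * 𝒮.ξ N * 𝒮.δ N * ideg 𝔓 r ≤ 𝒮.S N / 4 := by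
  have hδ := 𝒮.δ_pos N
  have hτ1 := 𝒮.one_le_τ N
  have hξ := 𝒮.ξ_le_g_div_C N
  have hξ0 := (𝒮.ξ_pos N).le
  have hg := 𝒮.g_pos N
  have hC := 𝒮.C_pos
  have hm : (0 : ℝ) ≤ (𝒮.m : ℝ) ^ 3 := by positivity
  have hD : (0 : ℝ) ≤ 𝒮.D₀ := Nat.cast_nonneg _
  -- `δ deg ≤ D₀ δ^k ≤ D₀ τ δ^k`
  have h1 : 𝒮.δ N * ideg 𝔓 r ≤ 𝒮.D₀ * (𝒮.τ N * 𝒮.δ N ^ 𝒮.k) := by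
    calc 𝒮.δ N * ideg 𝔓 r ≤ 𝒮.δ N * (𝒮.D₀ * 𝒮.δ N ^ (𝒮.r₀ - r)) :=
          mul_le_mul_of_nonneg_left hdeg hδ.le
      _ = 𝒮.D₀ * (𝒮.δ N * 𝒮.δ N ^ (𝒮.r₀ - r)) := by ring
      _ ≤ 𝒮.D₀ * 𝒮.δ N ^ 𝒮.k := mul_le_mul_of_nonneg_left (𝒮.δ_mul_pow_le_pow_k hr2 hrr N) hD
      _ ≤ 𝒮.D₀ * (𝒮.τ N * 𝒮.δ N ^ 𝒮.k) := by
          apply mul_le_mul_of_nonneg_left _ hD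
          exact le_mul_of_one_le_left (pow_nonneg hδ.le _) hτ1
  have hS : 𝒮.S N = 𝒮.g N * (𝒮.τ N * 𝒮.δ N ^ 𝒮.k) := 𝒮.S_eq N
  have hP : 0 ≤ 𝒮.τ N * 𝒮.δ N ^ 𝒮.k := by positivity
  -- `5 m³ ξ δ deg ≤ 5 m³ (g/C) D₀ τ δ^k = (20 m³ D₀ / C) S / 4 ≤ S/4`
  calc 5 * (𝒮.m : ℝ) ^ 3 * 𝒮.ξ N * 𝒮.δ N * ideg 𝔓 r
      = 5 * (𝒮.m : ℝ) ^ 3 * 𝒮.ξ N * (𝒮.δ N * ideg 𝔓 r) := by ring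
    _ ≤ 5 * (𝒮.m : ℝ) ^ 3 * (𝒮.g N / 𝒮.C) * (𝒮.D₀ * (𝒮.τ N * 𝒮.δ N ^ 𝒮.k)) := by
        apply mul_le_mul (mul_le_mul_of_nonneg_left hξ (by positivity)) h1 (by positivity)
          (by positivity)
    _ = (20 * (𝒮.m : ℝ) ^ 3 * 𝒮.D₀ / 𝒮.C) * (𝒮.g N * (𝒮.τ N * 𝒮.δ N ^ 𝒮.k)) / 4 := by
        field_simp; ring
    _ ≤ 1 * (𝒮.g N * (𝒮.τ N * 𝒮.δ N ^ 𝒮.k)) / 4 := by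
        apply div_le_div_of_nonneg_right _ (by norm_num)
        apply mul_le_mul_of_nonneg_right _ (by positivity)
        rwa [div_le_one hC]
    _ = 𝒮.S N / 4 := by rw [hS]; ring

/-! ### The cut -/

set_option maxHeartbeats 400000 in
/-- **The cut of the induction step** (Philippon 1986, Lemme 2.14, pp. 43–45, both cases). Let `𝔓`
be a homogeneous prime of rank exactly `r` (`2 ≤ r ≤ min(r₀, m)`) satisfying `(i)_N`, `(ii)_N` of
`(A_r)` at a level `N ≥ N₀`, with `Λ = Λ_r(N)` and `C`, `N` large as stated. Then for the level `M`
and a generator `E M i ∉ 𝔓` there is a homogeneous unmixed `J` of rank `r − 1` with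
`V(J) = V((𝔓, E M i))`, `|J(ω̄)| ≤ exp(−min(Λ size_N(𝔓), S(N))/2)`,
`size_N(J) ≤ 5 ξ(N) δ(N) (2 + m(k+3)) size_N(𝔓)` and `m³ deg J ≤ min(Λ size_N(𝔓), S(N))/4`.
[cite: Philippon1986Criteres, §3 Lemme 2.14 (pp. 43–45)]
[cite: NesterenkoPhilippon2001, Ch. 3 Prop. 4.11, Cor. 4.12 (pp. 40–41)] -/
theorem exists_cut (h44 : NesterenkoPhilippon2001_ch3_prop_4_4)
    (h411 : NesterenkoPhilippon2001_ch3_prop_4_11) (h412 : NesterenkoPhilippon2001_ch3_cor_4_12)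
    (h413 : NesterenkoPhilippon2001_ch3_prop_4_13) {lam : ℝ} {r : ℕ} (hr2 : 2 ≤ r)
    (hrr : r ≤ 𝒮.r₀) (hrm : r ≤ 𝒮.m) {N : ℕ} (hN : 𝒮.N₀ ≤ N) {𝔓 : Ideal (Rx 𝒮.m)}
    (h𝔓 : 𝔓.IsPrime) (h𝔓hom : 𝔓.IsHomogeneous (homogeneousSubmodule (Fin (𝒮.m + 1)) ℚ))
    (h𝔓unm : IsUnmixedOfRank 𝔓 r) (hdeg : (ideg 𝔓 r : ℝ) ≤ 𝒮.D₀ * 𝒮.δ N ^ (𝒮.r₀ - r))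
    (hh : iheight 𝔓 r ≤ 𝒮.B r * 𝒮.τ N * 𝒮.δ N ^ (𝒮.r₀ - r) / 𝒮.δ N)
    (hsmall : iabs 𝔓 r 𝒮.ω ≤ exp (-(𝒮.Λ lam r N * 𝒮.size N 𝔓 r)))
    (hΛa : 2 + 8 * r * (𝒮.m : ℝ) ^ 3 ≤ 𝒮.Λ lam r N)
    (hΛb : 2 * (1 + 11 * (𝒮.m : ℝ) ^ 2) ≤ 𝒮.Λ lam r N)
    (hΛc : 10 * (1 + 12 * (𝒮.m : ℝ) ^ 2) * 𝒮.ξ N ≤ 𝒮.Λ lam r N)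
    (hΛd : 20 * (𝒮.m : ℝ) ^ 3 * 𝒮.ξ N ≤ 𝒮.Λ lam r N)
    (hCa : 2 * (1 + 11 * (𝒮.m : ℝ) ^ 2) * (𝒮.B r + 𝒮.D₀) ≤ 𝒮.C) (hCb : 2 * (𝒮.m : ℝ) ≤ 𝒮.C)
    (hCc : log (4 * 𝒮.Θ ^ 2) ≤ 𝒮.C) (hCd : 20 * (𝒮.m : ℝ) ^ 3 * 𝒮.D₀ ≤ 𝒮.C)
    (hNbig : 𝒮.R 𝒮.N₀ + log (1 / 𝒮.κ) < 𝒮.Λ lam r N * 𝒮.τ N / (2 * r)) :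
    ∃ (M : ℕ) (i : Fin (𝒮.M M)) (J : Ideal (Rx 𝒮.m)), 𝒮.N₀ ≤ M ∧ M ≤ N ∧ 𝒮.E M i ∉ 𝔓 ∧
      J.IsHomogeneous (homogeneousSubmodule (Fin (𝒮.m + 1)) ℚ) ∧ IsUnmixedOfRank J (r - 1) ∧
      projZeros J = projZeros (𝔓 ⊔ Ideal.span {𝒮.E M i}) ∧
      iabs J (r - 1) 𝒮.ω ≤ exp (-(min (𝒮.Λ lam r N * 𝒮.size N 𝔓 r) (𝒮.S N) / 2)) ∧
      𝒮.size N J (r - 1) ≤ 5 * 𝒮.ξ N * 𝒮.δ N * (2 + 𝒮.m * (𝒮.k + 3)) * 𝒮.size N 𝔓 r ∧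
      (𝒮.m : ℝ) ^ 3 * ideg J (r - 1) ≤ min (𝒮.Λ lam r N * 𝒮.size N 𝔓 r) (𝒮.S N) / 4 := by
  classical
  -- notation and elementary facts
  set Λ : ℝ := 𝒮.Λ lam r N with hΛdef
  set s : ℝ := 𝒮.size N 𝔓 r with hsdef
  set A : ℝ := Λ * s with hAdef
  have hr1 : 1 ≤ r := by omega
  have hm0 : (0 : ℝ) ≤ 𝒮.m := Nat.cast_nonneg _
  have hr0 : (0 : ℝ) < r := by exact_mod_cast hr1
  have hΛ2 : 2 ≤ Λ := by nlinarith [mul_nonneg hr0.le (pow_nonneg hm0 3)]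
  have hΛ0 : 0 < Λ := by linarith
  have hdeg1 : 1 ≤ ideg 𝔓 r :=
    Literature.Barriers.Schanuel.one_le_ideg_of_isPrime h44 hr1 hrm h𝔓 h𝔓hom h𝔓unm
  have hdegR : (1 : ℝ) ≤ ideg 𝔓 r := by exact_mod_cast hdeg1
  have hδ := 𝒮.δ_pos N
  have hτ := 𝒮.τ_pos N
  have hτ1 := 𝒮.one_le_τ N
  have hδ1 := 𝒮.one_le_δ N
  have hξ1 := 𝒮.one_le_ξ N
  have hS0 := 𝒮.S_pos N
  have hs_ge : 𝒮.τ N * ideg 𝔓 r ≤ s := 𝒮.τ_mul_ideg_le_size N 𝔓 r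
  have hs1 : 1 ≤ s := le_trans (one_le_mul_of_one_le_of_one_le hτ1 hdegR) hs_ge
  have hs0 : 0 < s := by linarith
  have hA0 : 0 < A := mul_pos hΛ0 hs0
  have hcS := 𝒮.cS_mul_size_le_half_S hr1 N hdeg hh hCa
  rw [← hsdef] at hcS
  -- `(1+11m²) s ≤ A/2` and `5ξ(1+12m²) s ≤ A/2`
  have hcSA : (1 + 11 * (𝒮.m : ℝ) ^ 2) * s ≤ A / 2 := by
    rw [hAdef]; nlinarith [mul_le_mul_of_nonneg_right hΛb hs0.le]
  have hcS'A : 5 * 𝒮.ξ N * (1 + 12 * (𝒮.m : ℝ) ^ 2) * s ≤ A / 2 := by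
    rw [hAdef]; nlinarith [mul_le_mul_of_nonneg_right hΛc hs0.le]
  -- the level `M` and a generator
  obtain ⟨hne, hρle⟩ := 𝒮.rho_le_of_small h44 h413 hr1 hrm h𝔓 h𝔓hom h𝔓unm N hΛa hsmall
  have hρ0 : rho 𝒮.ω 𝔓 < 𝒮.κ * exp (-𝒮.R 𝒮.N₀) := by
    refine lt_of_le_of_lt hρle ?_
    have hκ := 𝒮.κ_pos
    rw [← exp_log hκ, ← exp_add, exp_lt_exp]
    have : log (1 / 𝒮.κ) = -log 𝒮.κ := by rw [one_div, log_inv]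
    rw [this] at hNbig
    have e : Λ * 𝒮.τ N / (2 * r) = 𝒮.Λ lam r N * 𝒮.τ N / (2 * r) := rfl
    linarith
  obtain ⟨M, hM0, hMN, hρM, hmax⟩ := 𝒮.exists_level hN hρ0
  obtain ⟨i, hi⟩ := 𝒮.exists_generator_not_mem hr2 h𝔓 h𝔓hom h𝔓unm hne hM0 hρM
  set E := 𝒮.E M i with hEdef
  set dE := 𝒮.d M i with hdEdef
  have hEhom : E.IsHomogeneous dE := 𝒮.isHomogeneous_E M i
  have hE0 : E ≠ 0 := fun h => hi (by rw [h]; exact 𝔓.zero_mem)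
  have hdE : (dE : ℝ) ≤ 𝒮.δ N := (𝒮.d_le M hM0 i).trans (𝒮.mono_δ hMN)
  have hdE0 : (0 : ℝ) ≤ dE := Nat.cast_nonneg _
  have hhE : height E ≤ 𝒮.τ N := ((𝒮.height_le M hM0 i).trans (𝒮.mono_σ hMN)).trans (𝒮.σ_le_τ N)
  have hvalE : normAt 𝒮.ω E ≤ exp (-𝒮.S M) := 𝒮.normAt_le M hM0 i
  have hX := 𝒮.bezout_exponent_le hMN hM0 i 𝔓 r
  have hY := 𝒮.bezout_exponent_le' hMN hM0 i 𝔓 r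
  rw [← hsdef] at hX hY
  -- Prop. 4.11's ideal `J'`
  obtain ⟨J', hJ'hom, hJ'unm, hJ'V, hJ'deg, hJ'h, hJ'small⟩ :=
    (h411 𝒮.m r 𝔓 E dE hr1 hrm h𝔓 h𝔓hom h𝔓unm hEhom (𝒮.one_le_d hM0 i hE0) hi).1 hr2
  have hJ'smallω := hJ'small 𝒮.ω 𝒮.ω_ne_zero
  -- size of `J'` (`t = 1`, `c = m(r+1)`)
  have hdeg0 : (0 : ℝ) ≤ ideg 𝔓 r := by linarith
  have hh0 : 0 ≤ iheight 𝔓 r := height_nonneg _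
  have hrk : (r : ℝ) ≤ 𝒮.k + 1 := by
    have := 𝒮.r₀_le; exact_mod_cast hrr.trans this
  have h5ξ : (1 : ℝ) ≤ 5 * 𝒮.ξ N := by linarith
  have hJ'degR : (ideg J' (r - 1) : ℝ) ≤ 1 * (ideg 𝔓 r * dE) := by
    rw [one_mul]; exact_mod_cast hJ'deg
  have hJ'hR : iheight J' (r - 1) ≤
      1 * (iheight 𝔓 r * dE + height E * ideg 𝔓 r + 𝒮.m * (r + 1) * (ideg 𝔓 r * dE)) := by
    refine hJ'h.trans (le_of_eq ?_); ring
  obtain ⟨hJ'size, hJ'deg3⟩ := 𝒮.size_of_cut_le hMN hM0 i le_rfl h5ξ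
    (mul_le_mul_of_nonneg_left (by linarith) hm0) hJ'degR hJ'hR
  rw [← hsdef] at hJ'size
  -- the degree term `5 m³ ξ δ deg 𝔓 ≤ min(A, S)/4`
  have hdegterm := 𝒮.deg_term_le_quarter_S hr2 hrr N hdeg hCd
  have hdegA : 5 * (𝒮.m : ℝ) ^ 3 * 𝒮.ξ N * 𝒮.δ N * ideg 𝔓 r ≤ A / 4 := by
    -- `20 m³ ξ ≤ Λ` and `δ deg ≤ τ deg ≤ s`
    have h1 : 𝒮.δ N * ideg 𝔓 r ≤ s := (mul_le_mul_of_nonneg_right (𝒮.δ_le_τ N) hdeg0).trans hs_ge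
    have h2 : 0 ≤ 𝒮.δ N * ideg 𝔓 r := by positivity
    calc 5 * (𝒮.m : ℝ) ^ 3 * 𝒮.ξ N * 𝒮.δ N * ideg 𝔓 r
        = (20 * (𝒮.m : ℝ) ^ 3 * 𝒮.ξ N) * (𝒮.δ N * ideg 𝔓 r) / 4 := by ring
      _ ≤ Λ * s / 4 := by
          apply div_le_div_of_nonneg_right _ (by norm_num)
          exact mul_le_mul hΛd h1 h2 hΛ0.le
  have hdegmin : 5 * (𝒮.m : ℝ) ^ 3 * 𝒮.ξ N * 𝒮.δ N * ideg 𝔓 r ≤ min A (𝒮.S N) / 4 := by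
    rw [le_div_iff₀ (by norm_num : (0:ℝ) < 4), le_min_iff]
    constructor <;> linarith
  have hJ'degterm : (𝒮.m : ℝ) ^ 3 * ideg J' (r - 1) ≤ min A (𝒮.S N) / 4 := hJ'deg3.trans hdegmin
  -- smallness helper: from `x ≤ exp(−min(A,S) + (1+11m²)s)` conclude `x ≤ exp(−min(A,S)/2)`
  have hmin2 : (1 + 11 * (𝒮.m : ℝ) ^ 2) * s ≤ min A (𝒮.S N) / 2 := by
    rw [le_div_iff₀ (by norm_num : (0:ℝ) < 2), le_min_iff]; constructor <;> linarith
  have hconclude : ∀ {x : ℝ}, x ≤ exp (-min A (𝒮.S N) + (1 + 11 * (𝒮.m : ℝ) ^ 2) * s) →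
      x ≤ exp (-(min A (𝒮.S N) / 2)) := fun hx =>
    hx.trans (exp_le_exp.mpr (by linarith))
  -- the exponent of Prop. 4.11 is `≤ (1 + 11 m²) s`
  have hexpX : exp (height E * ideg 𝔓 r + iheight 𝔓 r * dE + 11 * (𝒮.m : ℝ) ^ 2 * ideg 𝔓 r * dE)
      ≤ exp ((1 + 11 * (𝒮.m : ℝ) ^ 2) * s) := exp_le_exp.mpr hX
  have hsmallA : iabs 𝔓 r 𝒮.ω ≤ exp (-min A (𝒮.S N)) :=
    hsmall.trans (exp_le_exp.mpr (neg_le_neg (min_le_left _ _)))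
  by_cases hMeq : M = N
  · -- FIRST CASE `M = N`: `δ ≤ max(‖E‖, |𝔓|) ≤ exp(−min(A, S N))`
    subst hMeq
    refine ⟨M, i, J', hM0, le_rfl, hi, hJ'hom, hJ'unm, hJ'V, ?_, hJ'size, hJ'degterm⟩
    apply hconclude
    refine hJ'smallω.trans ?_
    have hmax : bezoutDelta 𝔓 r E 𝒮.ω ≤ exp (-min A (𝒮.S M)) := by
      refine (bezoutDelta_le_max 𝔓 r E 𝒮.ω).trans (max_le ?_ hsmallA)
      exact hvalE.trans (exp_le_exp.mpr (neg_le_neg (min_le_right _ _)))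
    calc bezoutDelta 𝔓 r E 𝒮.ω *
          exp (height E * ideg 𝔓 r + iheight 𝔓 r * dE + 11 * (𝒮.m : ℝ) ^ 2 * ideg 𝔓 r * dE)
        ≤ exp (-min A (𝒮.S M)) * exp ((1 + 11 * (𝒮.m : ℝ) ^ 2) * s) :=
          mul_le_mul hmax hexpX (exp_pos _).le (exp_pos _).le
      _ = exp (-min A (𝒮.S M) + (1 + 11 * (𝒮.m : ℝ) ^ 2) * s) := by rw [exp_add]
  · -- SECOND CASE `M < N`
    have hMlt : M < N := lt_of_le_of_ne hMN hMeq
    have hρge : 𝒮.κ * exp (-𝒮.R (M + 1)) ≤ rho 𝒮.ω 𝔓 := hmax hMlt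
    by_cases hEρ : normAt 𝒮.ω E ≤ rho 𝒮.ω 𝔓
    · -- `‖E‖ ≤ ρ`: `δ = |𝔓(ω̄)|`, no loss
      refine ⟨M, i, J', hM0, hMN, hi, hJ'hom, hJ'unm, hJ'V, ?_, hJ'size, hJ'degterm⟩
      apply hconclude
      refine hJ'smallω.trans ?_
      rw [bezoutDelta_of_le hEρ]
      calc iabs 𝔓 r 𝒮.ω *
            exp (height E * ideg 𝔓 r + iheight 𝔓 r * dE + 11 * (𝒮.m : ℝ) ^ 2 * ideg 𝔓 r * dE)
          ≤ exp (-min A (𝒮.S N)) * exp ((1 + 11 * (𝒮.m : ℝ) ^ 2) * s) :=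
            mul_le_mul hsmallA hexpX (exp_pos _).le (exp_pos _).le
        _ = exp (-min A (𝒮.S N) + (1 + 11 * (𝒮.m : ℝ) ^ 2) * s) := by rw [exp_add]
    · -- `ρ < ‖E‖`: Cor. 4.12 with `S* = A`, `η = ⌈4 ξ(M)⌉`
      set η : ℕ := ⌈4 * 𝒮.ξ M⌉₊ with hηdef
      have hη0 : 0 < η := 𝒮.eta_pos M
      have hηle : (η : ℝ) ≤ 5 * 𝒮.ξ N := 𝒮.eta_le hMN
      have hη1 : (1 : ℝ) ≤ η := by exact_mod_cast hη0
      have hiabs : iabs 𝔓 r 𝒮.ω ≤ exp (-A) := by rw [hAdef]; exact hsmall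
      have hnorm : normAt 𝒮.ω E ≤ exp (-(2 * (𝒮.m : ℝ) * dE)) := 𝒮.normAt_le_exp_deg hM0 i hCb
      have hpow : normAt 𝒮.ω E ^ η ≤ max (exp (-A)) (rho 𝒮.ω 𝔓) ^ 2 := by
        refine (𝒮.normAt_pow_eta_le_sq hM0 i hρge hCc).trans ?_
        exact pow_le_pow_left₀ (rho_nonneg _ _) (le_max_right _ _) 2
      obtain ⟨J, hJhom, hJunm, hJV, hJdeg, hJh, hJsmall⟩ :=
        (h412 𝒮.m r 𝔓 E dE hr1 hrm h𝔓 h𝔓hom h𝔓unm hE0 hEhom (𝒮.one_le_d hM0 i hE0) hi 𝒮.ω A η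
          𝒮.ω_ne_zero hA0 hη0 hiabs hnorm hpow).1 hr2
      -- size of `J` (`t = η`, `c = m(r+2)`)
      have hJdegR : (ideg J (r - 1) : ℝ) ≤ η * (ideg 𝔓 r * dE) := by
        have : (ideg J (r - 1) : ℝ) ≤ η * ideg 𝔓 r * dE := by exact_mod_cast hJdeg
        refine this.trans (le_of_eq ?_); ring
      have hJhR : iheight J (r - 1) ≤
          η * (iheight 𝔓 r * dE + height E * ideg 𝔓 r + 𝒮.m * (r + 2) * (ideg 𝔓 r * dE)) := by
        refine hJh.trans (le_of_eq ?_); ring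
      obtain ⟨hJsize, hJdeg3⟩ := 𝒮.size_of_cut_le hMN hM0 i hη1 hηle
        (mul_le_mul_of_nonneg_left (by linarith) hm0) hJdegR hJhR
      rw [← hsdef] at hJsize
      refine ⟨M, i, J, hM0, hMN, hi, hJhom, hJunm, hJV, ?_, hJsize, hJdeg3.trans hdegmin⟩
      -- smallness: `exp(−A + η Y) ≤ exp(−A/2) ≤ exp(−min/2)`
      refine hJsmall.trans ?_
      rw [exp_le_exp]
      have hYpos : 0 ≤ iheight 𝔓 r * (dE : ℝ) + height E * ideg 𝔓 r +
          12 * (𝒮.m : ℝ) ^ 2 * dE * ideg 𝔓 r := by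
        have := mul_nonneg hh0 hdE0
        have := mul_nonneg (height_nonneg E) hdeg0
        have : 0 ≤ 12 * (𝒮.m : ℝ) ^ 2 * dE * ideg 𝔓 r := by positivity
        linarith
      have hY' : (η : ℝ) * (iheight 𝔓 r * dE + height E * ideg 𝔓 r +
          12 * (𝒮.m : ℝ) ^ 2 * dE * ideg 𝔓 r) ≤ 5 * 𝒮.ξ N * ((1 + 12 * (𝒮.m : ℝ) ^ 2) * s) :=
        mul_le_mul hηle hY hYpos (by positivity)
      have hminA : min A (𝒮.S N) ≤ A := min_le_left _ _
      have e : 5 * 𝒮.ξ N * ((1 + 12 * (𝒮.m : ℝ) ^ 2) * s) = 5 * 𝒮.ξ N * (1 + 12 * (𝒮.m : ℝ) ^ 2) * s := by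
        ring
      linarith

end Setup

end PhilipponMain

end Literature.NumberTheory.Transcendental

end
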